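import Summits.ABC.IUTFork.ForkGenuineWindowSharpExplicit
import Summits.ABC.IUTFork.ForkGenuineRegimes
import Summits.ABC.IUTFork.LDHExplicitDeltaSplit
import HarnessLib

/-!
# The fork at [IUTchIII] Corollary 3.12 at a GENUINE input: the SHARP SHALLOW REGIME — Cor. 3.12 HOLDS by volume
# arithmetic whenever `κ_l·deĝ̲(𝔮) ≤ slotResidue + D_expl + ((l+5)/4)·log π` (Dupuy–Hilado §4.12; [IUTchIV] §1)

Record-only PROOF file (D-0012) of the abc-iut cell (seat abc-iut-w6-d018, sequel of R2 TARGET #1 «Rest_lower»); TAKES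
NO SIDE. Sequel to `ForkGenuineRegimes` (abc-iut-skel: `cor312Of_of_shallow` — `κ_l·deĝ̲(𝔮) ≤ ((l+5)/4)·log π ⟹ Cor312Of
I`; `not_cor312Of_of_deep`), `ForkGenuineWindow` (`cor312Of_of_le_lowerWindow`, the `δ_Λ` lower window), and to the
SHARP lower window of this lineage: `ForkGenuineWindowSharp.neg_ndegLgpSlotMin_add_dSharp_le_negLogThetaNonarch`
(`−ndegLgpSlotMin + D♯ ≤ negLogThetaNonarch I`) and abc-iut-S4's
`ForkGenuineWindowSharpExplicit.neg_ndegLgpSlotMin_add_dExplicit_le_negLogThetaNonarch` / `dExplicit_eq_closedForm`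
(`D_expl(I) = Σ_{p∈T(I)} (((ℓ⋇+3)/2)·Σ_{u|p} Pr(u)·d(K_{u̲}) − Σ_{u|p} d(K_{u̲}))·log p ≤ D♯(I)`). HERE the POSITIVE
direction of the dispute's inequality that these lower windows give for free, in the `κ_l·deĝ̲(𝔮)` currency of
`ForkGenuineRegimes` (`κ_l := (l+1)/24 − 1/(2l)`, `deĝ̲_lgp(P_Θ) − deĝ̲(P_q) = κ_l·deĝ̲(𝔮)`):

* **`cor312Of_of_gap_le_dSharp`** / **`cor312Of_of_gap_le_dExplicit`** — `κ_l·deĝ̲(𝔮) ≤ slotResidue(T(I)) + D♯(I) +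
  ((l+5)/4)·log π ⟹ Cor312Of I`, resp. with `D_expl(I)`; **`cor312Of_of_gap_le_closedForm`** — the same with S4's closed
  form: **[IUTchIII] Cor. 3.12 HOLDS, as a kernel theorem about the tree's typed numbers, at EVERY genuine input whose
  `q`-divisor degree satisfies `κ_l·deĝ̲(𝔮) ≤ slotResidue + Σ_p (((ℓ⋇+3)/2)·Σ_u Pr(u)·d(K_{u̲}) − Σ_u d(K_{u̲}))·log p +
  ((l+5)/4)·log π`** — no indeterminacy beyond (Ind1)/(Ind2) as typed, no anabelian input: the hull of the possible
  images is simply that large (the different of the packets is realised, `TensorPacketContentSharp`);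
* **`cor312Of_sharpRegimes`** — together with the deep regime (`not_cor312Of_of_deep`, c312-d1's `explicitDelta =
  slotResidue + explicitDeltaRest`): `κ_l·deĝ̲(𝔮) ≤ slotResidue + D_expl + arch ⟹ Cor312Of I ⟹ κ_l·deĝ̲(𝔮) ≤ slotResidue +
  explicitDeltaRest + arch`. The truth value of the typed Cor. 3.12 at a genuine input is UNDECIDED BY ARITHMETIC only
  inside the band `explicitDeltaRest − D_expl = Σ_p (1/ℓ⋇)Σ_jΣ_{v⃗}({Σ_{u|p} d(K_{u̲}) + 1}·log p + Σ_{e_a>p−2}{3+log e_a})·Π Pr`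
  — of the size of ONE unweighted different per support prime plus the tame/wild constants, against thresholds of size
  `((l+5)/4)·log(𝔡^K)`;
* `PointDict.cor312Of_of_logQAvoid_le_closedForm` — at the `λ`-line: a genuine datum `T` of `(P, l)` (`λ ∈ U_X`)
  satisfies `T.Cor312Of` as soon as `κ_l·log(q^{∤{2,l}}(λ)) ≤ slotResidue(T) + D_expl(T) + ((l+5)/4)·log π`.

READING (numbers, not a side): with `D_expl ≈ ((l+5)/4)·log(𝔡^K)` and `κ_l ≈ (l+1)/24` the sharp shallow regime is
`log(q) ≲ 6·(1+4/l)·log(𝔡^K) + 6·log π + (24/(l+1))·slotResidue`: every genuine input whose curve is SZPIRO-SHALLOW in this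
explicit sense satisfies the typed Cor. 3.12 by volume computation alone, and every input violating the deep threshold
refutes it; print's Cor. 3.12 is the claim for ALL inputs. Nothing here asserts which regime the Θ-data of a given curve
occupy; (Ind1)/(Ind2)/hull are the tree's typings of the disputed corpus [claim: Mochizuki2012, status: disputed]; the
volume algebra is classical; no side taken on [IUTchIII] Cor. 3.12; typed ≠ proved. PROOF-ONLY file.
[cite: Mochizuki2012, IUTchIII Cor. 3.12 p. 173–174] [cite: Mochizuki2012, IUTchIV Thm. 1.10 Steps (v)–(viii) p. 27–30]
[cite: DupuyHilado2025, §4.12]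
-/

noncomputable section

open Set Literature.IUT.LogVolume NumberField IsDedekindDomain
open scoped Pointwise

namespace Summit.ABC.IUTFork.GenuineContent

section Regimes

variable {F₀ : Type} [Field F₀] [NumberField F₀] {K : Type} [Field K] [NumberField K] [Algebra F₀ K]
variable (I : ThetaVolumeInput F₀ K)

/-! ## 1. The sharp shallow regime at a genuine input -/

/-- **Cor. 3.12 at the input from the SHARP lower window**: if the gap `deĝ̲_lgp(P_Θ) − deĝ̲(P_q)` is at most
`slotResidue(T(I)) + D♯(I) + ((l+5)/4)·log π`, then `Cor312Of I` (`−deĝ̲(P_q) ≤ −ndegLgpSlotMin + D♯ + arch ≤ −|log(Θ)|`).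
A kernel theorem about the typed numbers; no side taken on the inference of Cor. 3.12 for all inputs.
[cite: Mochizuki2012, IUTchIII Cor. 3.12 p. 173–174] [cite: DupuyHilado2025, §4.12] -/
theorem cor312Of_of_gap_le_dSharp
    (h : LgpDivisor.ndegLgp I.X.thetaPilot - FinDivisor.ndeg F₀ I.X.qPilot ≤
      I.X.slotResidue I.supportPrimes
        + ∑ p ∈ I.supportPrimes, (1 / (I.X.lstar : ℝ)) * ∑ i : Fin I.X.lstar,
            ∑ e : Fin ((i : ℕ) + 1 + 1) → placesOver F₀ p,
              (if hp : p.Prime then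
                haveI : Fact p.Prime := ⟨hp⟩
                (dSum p (fun b => (I.σ.localFieldFamily p hp).k (e b))
                  - (Finset.univ : Finset (DIdx p (fun b => (I.σ.localFieldFamily p hp).k (e b)))).inf'
                      Finset.univ_nonempty
                      (fun J => differentOrd p (DFac p (fun b => (I.σ.localFieldFamily p hp).k (e b)) J)))
                  * Real.log p
               else 0) * ∏ b, weight F₀ (e b).1
        + ThetaVolumeInput.archLogTheta I.l) :
    I.Cor312Of := by
  have hl := neg_ndegLgpSlotMin_add_dSharp_le_negLogThetaNonarch I
  have hs : I.X.slotResidue I.supportPrimes =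
      LgpDivisor.ndegLgp I.X.thetaPilot - I.X.ndegLgpSlotMin I.supportPrimes := (DHData.ofInput I).slotResidue_eq
  unfold ThetaVolumeInput.Cor312Of ThetaVolumeInput.negLogTheta ThetaVolumeInput.negAbsLogQ
  rw [hs] at h
  linarith

/-- **Cor. 3.12 at the input from the EXPLICIT sharp lower window** (abc-iut-S4's `D_expl ≤ D♯`): if the gap is at most
`slotResidue(T(I)) + D_expl(I) + ((l+5)/4)·log π`, then `Cor312Of I`. [cite: Mochizuki2012, IUTchIII Cor. 3.12 p. 173–174]
[cite: DupuyHilado2025, §4.12] -/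
theorem cor312Of_of_gap_le_dExplicit
    (h : LgpDivisor.ndegLgp I.X.thetaPilot - FinDivisor.ndeg F₀ I.X.qPilot ≤
      I.X.slotResidue I.supportPrimes
        + ∑ p ∈ I.supportPrimes, (1 / (I.X.lstar : ℝ)) * ∑ i : Fin I.X.lstar,
            ∑ e : Fin ((i : ℕ) + 1 + 1) → placesOver F₀ p,
              (if hp : p.Prime then
                haveI : Fact p.Prime := ⟨hp⟩
                (dSum p (fun b => (I.σ.localFieldFamily p hp).k (e b))
                  - dSum p (fun u : placesOver F₀ p => (I.σ.localFieldFamily p hp).k u)) * Real.log p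
               else 0) * ∏ b, weight F₀ (e b).1
        + ThetaVolumeInput.archLogTheta I.l) :
    I.Cor312Of := by
  have hl := neg_ndegLgpSlotMin_add_dExplicit_le_negLogThetaNonarch I
  have hs : I.X.slotResidue I.supportPrimes =
      LgpDivisor.ndegLgp I.X.thetaPilot - I.X.ndegLgpSlotMin I.supportPrimes := (DHData.ofInput I).slotResidue_eq
  unfold ThetaVolumeInput.Cor312Of ThetaVolumeInput.negLogTheta ThetaVolumeInput.negAbsLogQ
  rw [hs] at h
  linarith

/-- **THE SHARP SHALLOW REGIME IN CLOSED FORM**: [IUTchIII] Cor. 3.12 HOLDS at every genuine input with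
`κ_l·deĝ̲(𝔮) ≤ slotResidue(T(I)) + Σ_{p∈T(I)} (((ℓ⋇+3)/2)·Σ_{u|p} Pr(u)·d(K_{u̲}) − Σ_{u|p} d(K_{u̲}))·log p + ((l+5)/4)·log π`
(`κ_l = (l+1)/24 − 1/(2l)`; S4's `dExplicit_eq_closedForm`). Compared with `cor312Of_of_shallow` the threshold is raised by
the (Ind1) slot residue and by the realised different `≈ ((l+5)/4)·log(𝔡^K)`: roughly `log(q) ≲ 6·(1+4/l)·log(𝔡^K) + 6 log π`
— a Szpiro-shallow input satisfies the typed Cor. 3.12 by volume arithmetic alone. No side taken on the claim for all inputs.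
[cite: Mochizuki2012, IUTchIII Cor. 3.12 p. 173–174] [cite: Mochizuki2012, IUTchIV Thm. 1.10 Step (v) p. 27–29] -/
theorem cor312Of_of_gap_le_closedForm
    (h : (((I.X.l : ℝ) + 1) / 24 - 1 / (2 * (I.X.l : ℝ))) * FinDivisor.ndeg F₀ I.X.qDivisor ≤
      I.X.slotResidue I.supportPrimes
        + ∑ p ∈ I.supportPrimes,
            (if hp : p.Prime then
              haveI : Fact p.Prime := ⟨hp⟩
              ((((I.X.lstar : ℝ) + 3) / 2) *
                  ∑ u : placesOver F₀ p, weight F₀ u.1 * differentOrd p ((I.σ.localFieldFamily p hp).k u)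
                - dSum p (fun u : placesOver F₀ p => (I.σ.localFieldFamily p hp).k u)) * Real.log p
             else 0)
        + ThetaVolumeInput.archLogTheta I.l) :
    I.Cor312Of := by
  rw [← dExplicit_eq_closedForm] at h
  refine cor312Of_of_gap_le_dExplicit I ?_
  have hΘ := DHData.ndegLgp_thetaPilot_eq I.X
  have hq : FinDivisor.ndeg F₀ I.X.qPilot = (1 / (2 * (I.X.l : ℝ))) * FinDivisor.ndeg F₀ I.X.qDivisor := by
    have := I.negAbsLogQ_eq
    unfold ThetaVolumeInput.negAbsLogQ at this
    linarith
  rw [hΘ, hq]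
  have hsplit : (((I.X.l : ℝ) + 1) / 24 - 1 / (2 * (I.X.l : ℝ))) * FinDivisor.ndeg F₀ I.X.qDivisor =
      ((I.X.l : ℝ) + 1) / 24 * FinDivisor.ndeg F₀ I.X.qDivisor
        - 1 / (2 * (I.X.l : ℝ)) * FinDivisor.ndeg F₀ I.X.qDivisor := sub_mul _ _ _
  linarith

/-! ## 2. The two sharp regimes together -/

/-- **THE SHARP REGIMES** (the arithmetic locus of the dispute at a genuine input, both sides explicit): with
`κ_l = (l+1)/24 − 1/(2l)`, `N = deĝ̲(𝔮)`, `arch = ((l+5)/4)·log π`: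
`κ_l·N ≤ slotResidue + D_expl + arch ⟹ Cor312Of I` and `Cor312Of I ⟹ κ_l·N ≤ slotResidue + explicitDeltaRest + arch`
(c312-d1's `explicitDelta = slotResidue + explicitDeltaRest` in `not_cor312Of_of_deep`). Strictly between the two
thresholds — a band of width `explicitDeltaRest − D_expl`, one unweighted different per support prime plus the tame/wild
constants of [IUTchIV] Step (v) — arithmetic alone does not decide; there the lattice contents decide (abc-iut-c312-3's
`cor312Of_iff_of_content`). Nothing asserted about which side a given curve's Θ-data fall; no side taken.
[cite: Mochizuki2012, IUTchIV Thm. 1.10 Steps (v)–(viii) p. 27–30] [claim: Mochizuki2012, status: disputed] -/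
theorem cor312Of_sharpRegimes :
    ((((I.X.l : ℝ) + 1) / 24 - 1 / (2 * (I.X.l : ℝ))) * FinDivisor.ndeg F₀ I.X.qDivisor ≤
        I.X.slotResidue I.supportPrimes
          + ∑ p ∈ I.supportPrimes,
              (if hp : p.Prime then
                haveI : Fact p.Prime := ⟨hp⟩
                ((((I.X.lstar : ℝ) + 3) / 2) *
                    ∑ u : placesOver F₀ p, weight F₀ u.1 * differentOrd p ((I.σ.localFieldFamily p hp).k u)
                  - dSum p (fun u : placesOver F₀ p => (I.σ.localFieldFamily p hp).k u)) * Real.log p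
               else 0)
          + ThetaVolumeInput.archLogTheta I.l → I.Cor312Of) ∧
    (I.Cor312Of → (((I.X.l : ℝ) + 1) / 24 - 1 / (2 * (I.X.l : ℝ))) * FinDivisor.ndeg F₀ I.X.qDivisor ≤
        I.X.slotResidue I.supportPrimes + DHData.explicitDeltaRest I + ThetaVolumeInput.archLogTheta I.l) := by
  refine ⟨cor312Of_of_gap_le_closedForm I, fun hc => ?_⟩
  have h2 := (cor312Of_regimes I).2 hc
  rw [DHData.explicitDelta_eq_slotResidue_add_rest] at h2
  linarith

end Regimes

end Summit.ABC.IUTFork.GenuineContent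

/-! ## 3. At the `λ`-line -/

namespace Summit.ABC.IUTFork.PointDict

open Literature.NumberTheory.DiophantineGeometry.GenEll

variable {P : NFPoint} {l : ℕ}

/-- **Cor. 3.12 at a genuine datum of `(P, l)` from the sharp shallow regime**: for `λ ∈ U_X` and a genuine Θ-volume
datum `T` at `(P, l)`, if `((l+1)/24 − 1/(2l))·log(q^{∤{2,l}}(λ)) ≤ slotResidue(T) + D_expl(T) + ((l+5)/4)·log π` (with S4's
closed form of `D_expl(T)` in the differents of the datum's completions `K_{u̲}`), then `T.Cor312Of` — the typed
[IUTchIII] Cor. 3.12 holds AT THAT DATUM by volume arithmetic (`gap_eq`: the gap is `κ_l·log(q^{∤{2,l}}(λ))`). Nothing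
asserted about the existence of data or about other data; no side taken. [claim: Mochizuki2012, status: disputed] -/
theorem cor312Of_of_logQAvoid_le_closedForm (T : Cor22.ThetaVolumeDatumAt P l) (hU : P.InU)
    (h : (letI := T.instFieldF; letI := T.instNumberFieldF; letI := T.instFieldK; letI := T.instNumberFieldK
      letI := T.instAlgebraK; letI := T.instIsElliptic
      (((l : ℝ) + 1) / 24 - 1 / (2 * l)) * Cor22.logQAvoid P {2, l} ≤
        T.I.X.slotResidue T.I.supportPrimes
          + ∑ p ∈ T.I.supportPrimes,
              (if hp : p.Prime then
                haveI : Fact p.Prime := ⟨hp⟩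
                ((((T.I.X.lstar : ℝ) + 3) / 2) *
                    ∑ u : placesOver (Literature.IUT.HodgeTheaters.fieldOfModuli T.E) p,
                      weight (Literature.IUT.HodgeTheaters.fieldOfModuli T.E) u.1 *
                        differentOrd p ((T.I.σ.localFieldFamily p hp).k u)
                  - dSum p (fun u : placesOver (Literature.IUT.HodgeTheaters.fieldOfModuli T.E) p =>
                      (T.I.σ.localFieldFamily p hp).k u)) * Real.log p
               else 0)
          + ThetaVolumeInput.archLogTheta T.I.l)) :
    T.Cor312Of := by
  letI := T.instFieldF; letI := T.instNumberFieldF; letI := T.instFieldK; letI := T.instNumberFieldK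
  letI := T.instAlgebraK; letI := T.instIsElliptic
  have hgap := gap_eq T hU
  have hgap' : T.gap = LgpDivisor.ndegLgp T.I.X.thetaPilot - FinDivisor.ndeg _ T.I.X.qPilot := rfl
  rw [← hgap, hgap', ← GenuineContent.dExplicit_eq_closedForm] at h
  exact GenuineContent.cor312Of_of_gap_le_dExplicit T.I h

end Summit.ABC.IUTFork.PointDict

end
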